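import Summits.ValiantsHypothesis.ValiantsHypothesis.Theorems.SymPencilPerFourInnerRankSlots
import Summits.ValiantsHypothesis.ValiantsHypothesis.Theorems.SymPencilPerFourPeeledTwoPencilFrameless

/-!
# Route `SymPencil` — inner rank of the `2 | 2` row split of `per_4`, PEELED case: the FLIP of the
# pointwise two-pencil reduction (`--supports` stmt-ValiantsHypothesis-5674 `SdcSuperquadratic`;
# (8,8) column, desk #370 (C); rung currency only)

Besides the mirror `(a,b,y,z) ↦ (b,a,z,y)` of `…TwoPencilFrameless` (which exchanges the two
correction matrices `Ψ ↔ Ψ′`), a reduced peeled family has the FLIP symmetry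
`t^f_r(p)(q) = t_r(q)(p)` (rows `(02)(13)` of the permanent), which TRANSPOSES both correction
matrices.  Hence (`false_of_peeled_of_frame_at_flip`) a frame for `Ψᵀ` also kills the family, and
(★ `exists_frameless_quadruple_of_peeled`; the row symmetry of `per` is ✓ `…InnerRankSlots.per_swap_pairs`) a reduced peeled family on `≤ 11` squares has
`Ψ, Ψᵀ, Ψ′, Ψ′ᵀ` ALL frameless — the coverage programme (memo §9) may use whichever of the four is
convenient (e.g. zero COLUMNS of `Ψ` are zero ROWS of `Ψᵀ`).

Honest framing: no cell closes here; the window `28 ≤ sdc(per₄) ≤ 29` of record, the crux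
`SdcSuperquadratic` and `VP ≠ VNP` are untouched.  No definitions, no named facts. [folklore]
-/

noncomputable section

-- single-conjunct layout: Sub = Summit, duplicated namespace component intended
set_option linter.dupNamespace false

namespace Summit.ValiantsHypothesis.ValiantsHypothesis.Theorems.SymPencilPerFourPeeledTwoPencilFramelessFlip

open Matrix Finset Module
open Summit.ValiantsHypothesis.ValiantsHypothesis.Theorems.SymPencilPerFourPeeledTwoPencilFrameless

universe u v

variable {K : Type u} [Field K]

/-- **Flip.**  A frame for `Ψᵀ` kills the family: the flipped family `t^f_r(p)(q) = t_r(q)(p)` is a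
reduced peeled family whose first correction matrix is `Ψᵀ`. [folklore] -/
theorem false_of_peeled_of_frame_at_flip [CharZero K] {κ : Type v} [Fintype κ] [DecidableEq κ]
    (hκ : Fintype.card κ ≤ 11) (c : κ → K)
    (t : κ → (((Fin 4 → K) × (Fin 4 → K)) →ₗ[K] ((Fin 4 → K) × (Fin 4 → K)) →ₗ[K] K))
    (hJ : ∀ a b y₂ y₃ : Fin 4 → K,
      ∑ r, c r * (t r (a, b) (y₂, y₃)) ^ 2 = (Matrix.of ![a, b, y₂, y₃]).permanent)
    (v₀ v₀' : κ → K) (hv₀ : ∀ (a x : Fin 4 → K), ∃ s : K, (fun r => t r (a, 0) (x, 0)) = s • v₀)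
    (hv₀' : ∀ (b x : Fin 4 → K), ∃ s : K, (fun r => t r (0, b) (0, x)) = s • v₀')
    (hpeel : ∃ a b y z : Fin 4 → K, ∑ r, c r * t r (a, 0) (y, 0) * t r (0, b) (0, z) ≠ 0)
    (hframeT : ∀ Ψ : Matrix (Fin 4) (Fin 4) K,
      (∀ (a x : Fin 4 → K) (r : κ), t r (a, 0) (x, 0) = (a ⬝ᵥ Ψ *ᵥ x) * v₀ r) →
      ∃ (a₀ a₁ y₀ y₁ : Fin 4 → K) (P₀₀ P₁₀ P₀₁ P₁₁ W₀ : Matrix (Fin 4) (Fin 4) K)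
        (v : Fin 4 → Fin 4 → K) (s : Fin 4 → K) (W : Matrix (Fin 4) (Fin 4) K),
        a₀ ⬝ᵥ Ψᵀ *ᵥ y₀ = 0 ∧ a₀ ⬝ᵥ Ψᵀ *ᵥ y₁ = 0 ∧ a₁ ⬝ᵥ Ψᵀ *ᵥ y₀ = 0 ∧ a₁ ⬝ᵥ Ψᵀ *ᵥ y₁ = 0 ∧
        (∀ b l, P₀₀ b l = (Matrix.of ![a₀, Pi.single b 1, y₀, Pi.single l 1]).permanent) ∧
        (∀ b l, P₁₀ b l = (Matrix.of ![a₀, Pi.single b 1, y₁, Pi.single l 1]).permanent) ∧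
        (∀ b l, P₀₁ b l = (Matrix.of ![a₁, Pi.single b 1, y₀, Pi.single l 1]).permanent) ∧
        (∀ b l, P₁₁ b l = (Matrix.of ![a₁, Pi.single b 1, y₁, Pi.single l 1]).permanent) ∧
        W₀ * P₀₀ = 1 ∧ (∀ j, P₁₀ *ᵥ v j = s j • P₀₀ *ᵥ v j) ∧ (∀ i j, i ≠ j → s i ≠ s j) ∧
        W * Matrix.of v = 1 ∧ P₁₁ - P₁₀ * W₀ * P₀₁ ≠ 0) :
    False := by
  classical
  let tf : κ → (((Fin 4 → K) × (Fin 4 → K)) →ₗ[K] ((Fin 4 → K) × (Fin 4 → K)) →ₗ[K] K) :=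
    fun r => (t r).flip
  have htf : ∀ r (p q : (Fin 4 → K) × (Fin 4 → K)), tf r p q = t r q p := fun r p q => rfl
  refine false_of_peeled_of_frame_at hκ c tf ?_ v₀ v₀' ?_ ?_ ?_ ?_
  · intro a b y₂ y₃
    simp only [htf]
    rw [hJ y₂ y₃ a b, SymPencilPerFourInnerRankSlots.per_swap_pairs]
  · intro a x
    obtain ⟨s, hs⟩ := hv₀ x a
    exact ⟨s, by simpa only [htf] using hs⟩
  · intro b x
    obtain ⟨s, hs⟩ := hv₀' x b
    exact ⟨s, by simpa only [htf] using hs⟩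
  · obtain ⟨a, b, y, z, hne⟩ := hpeel
    refine ⟨y, z, a, b, ?_⟩
    simpa only [htf] using hne
  · intro Ψ hΨ
    -- `Ψ` represents the flipped block, so `Ψᵀ` represents the original one
    have hΨT : ∀ (a x : Fin 4 → K) (r : κ), t r (a, 0) (x, 0) = (a ⬝ᵥ Ψᵀ *ᵥ x) * v₀ r := by
      intro a x r
      rw [← htf r (x, 0) (a, 0), hΨ x a r, Matrix.dotProduct_mulVec, Matrix.mulVec_transpose,
        dotProduct_comm a]
    have := hframeT Ψᵀ hΨT
    simpa only [Matrix.transpose_transpose] using this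

/-- **Mirror + flip.**  A frame for `Ψ′ᵀ` kills the family. [folklore] -/
theorem false_of_peeled_of_frame_at_mirror_flip [CharZero K] {κ : Type v} [Fintype κ]
    [DecidableEq κ]
    (hκ : Fintype.card κ ≤ 11) (c : κ → K)
    (t : κ → (((Fin 4 → K) × (Fin 4 → K)) →ₗ[K] ((Fin 4 → K) × (Fin 4 → K)) →ₗ[K] K))
    (hJ : ∀ a b y₂ y₃ : Fin 4 → K,
      ∑ r, c r * (t r (a, b) (y₂, y₃)) ^ 2 = (Matrix.of ![a, b, y₂, y₃]).permanent)
    (v₀ v₀' : κ → K) (hv₀ : ∀ (a x : Fin 4 → K), ∃ s : K, (fun r => t r (a, 0) (x, 0)) = s • v₀)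
    (hv₀' : ∀ (b x : Fin 4 → K), ∃ s : K, (fun r => t r (0, b) (0, x)) = s • v₀')
    (hpeel : ∃ a b y z : Fin 4 → K, ∑ r, c r * t r (a, 0) (y, 0) * t r (0, b) (0, z) ≠ 0)
    (hframe : ∀ Ψ' : Matrix (Fin 4) (Fin 4) K,
      (∀ (b x : Fin 4 → K) (r : κ), t r (0, b) (0, x) = (b ⬝ᵥ Ψ' *ᵥ x) * v₀' r) →
      ∃ (a₀ a₁ y₀ y₁ : Fin 4 → K) (P₀₀ P₁₀ P₀₁ P₁₁ W₀ : Matrix (Fin 4) (Fin 4) K)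
        (v : Fin 4 → Fin 4 → K) (s : Fin 4 → K) (W : Matrix (Fin 4) (Fin 4) K),
        a₀ ⬝ᵥ Ψ'ᵀ *ᵥ y₀ = 0 ∧ a₀ ⬝ᵥ Ψ'ᵀ *ᵥ y₁ = 0 ∧ a₁ ⬝ᵥ Ψ'ᵀ *ᵥ y₀ = 0 ∧ a₁ ⬝ᵥ Ψ'ᵀ *ᵥ y₁ = 0 ∧
        (∀ b l, P₀₀ b l = (Matrix.of ![a₀, Pi.single b 1, y₀, Pi.single l 1]).permanent) ∧
        (∀ b l, P₁₀ b l = (Matrix.of ![a₀, Pi.single b 1, y₁, Pi.single l 1]).permanent) ∧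
        (∀ b l, P₀₁ b l = (Matrix.of ![a₁, Pi.single b 1, y₀, Pi.single l 1]).permanent) ∧
        (∀ b l, P₁₁ b l = (Matrix.of ![a₁, Pi.single b 1, y₁, Pi.single l 1]).permanent) ∧
        W₀ * P₀₀ = 1 ∧ (∀ j, P₁₀ *ᵥ v j = s j • P₀₀ *ᵥ v j) ∧ (∀ i j, i ≠ j → s i ≠ s j) ∧
        W * Matrix.of v = 1 ∧ P₁₁ - P₁₀ * W₀ * P₀₁ ≠ 0) :
    False := by
  classical
  -- the mirrored family (as in `…TwoPencilFrameless`)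
  let sw : ((Fin 4 → K) × (Fin 4 → K)) →ₗ[K] ((Fin 4 → K) × (Fin 4 → K)) :=
    (LinearEquiv.prodComm K (Fin 4 → K) (Fin 4 → K)).toLinearMap
  let tm : κ → (((Fin 4 → K) × (Fin 4 → K)) →ₗ[K] ((Fin 4 → K) × (Fin 4 → K)) →ₗ[K] K) :=
    fun r => ((t r).comp sw).compl₂ sw
  have htm : ∀ r (a b y z : Fin 4 → K), tm r (a, b) (y, z) = t r (b, a) (z, y) := by
    intro r a b y z; rfl
  refine false_of_peeled_of_frame_at_flip hκ c tm ?_ v₀' v₀ ?_ ?_ ?_ ?_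
  · intro a b y₂ y₃
    simp only [htm]
    rw [hJ b a y₃ y₂, SymPencilPerFourInnerRankRows.per_swap_row₀₁,
      SymPencilPerFourInnerRankRows.per_swap_row₂₃]
  · intro a x
    obtain ⟨s, hs⟩ := hv₀' a x
    exact ⟨s, by simpa only [htm] using hs⟩
  · intro b x
    obtain ⟨s, hs⟩ := hv₀ b x
    exact ⟨s, by simpa only [htm] using hs⟩
  · obtain ⟨a, b, y, z, hne⟩ := hpeel
    refine ⟨b, a, z, y, ?_⟩
    simp only [htm]
    convert hne using 2 with r
    ring
  · intro Ψ' hΨ'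
    exact hframe Ψ' (fun b x r => by rw [← htm]; exact hΨ' b x r)

/-- ★ **A reduced peeled family on `≤ 11` squares has `Ψ, Ψᵀ, Ψ′, Ψ′ᵀ` all frameless.**
[folklore] -/
theorem exists_frameless_quadruple_of_peeled [CharZero K] {κ : Type v} [Fintype κ]
    [DecidableEq κ]
    (hκ : Fintype.card κ ≤ 11) (c : κ → K)
    (t : κ → (((Fin 4 → K) × (Fin 4 → K)) →ₗ[K] ((Fin 4 → K) × (Fin 4 → K)) →ₗ[K] K))
    (hJ : ∀ a b y₂ y₃ : Fin 4 → K,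
      ∑ r, c r * (t r (a, b) (y₂, y₃)) ^ 2 = (Matrix.of ![a, b, y₂, y₃]).permanent)
    (v₀ v₀' : κ → K) (hv₀ : ∀ (a x : Fin 4 → K), ∃ s : K, (fun r => t r (a, 0) (x, 0)) = s • v₀)
    (hv₀' : ∀ (b x : Fin 4 → K), ∃ s : K, (fun r => t r (0, b) (0, x)) = s • v₀')
    (hpeel : ∃ a b y z : Fin 4 → K, ∑ r, c r * t r (a, 0) (y, 0) * t r (0, b) (0, z) ≠ 0) :
    ∃ Ψ Ψ' : Matrix (Fin 4) (Fin 4) K,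
      (∀ (a x : Fin 4 → K) (r : κ), t r (a, 0) (x, 0) = (a ⬝ᵥ Ψ *ᵥ x) * v₀ r) ∧
      (∀ (b x : Fin 4 → K) (r : κ), t r (0, b) (0, x) = (b ⬝ᵥ Ψ' *ᵥ x) * v₀' r) ∧
      (¬
      ∃ (a₀ a₁ y₀ y₁ : Fin 4 → K) (P₀₀ P₁₀ P₀₁ P₁₁ W₀ : Matrix (Fin 4) (Fin 4) K)
        (v : Fin 4 → Fin 4 → K) (s : Fin 4 → K) (W : Matrix (Fin 4) (Fin 4) K),
        a₀ ⬝ᵥ Ψ *ᵥ y₀ = 0 ∧ a₀ ⬝ᵥ Ψ *ᵥ y₁ = 0 ∧ a₁ ⬝ᵥ Ψ *ᵥ y₀ = 0 ∧ a₁ ⬝ᵥ Ψ *ᵥ y₁ = 0 ∧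
        (∀ b l, P₀₀ b l = (Matrix.of ![a₀, Pi.single b 1, y₀, Pi.single l 1]).permanent) ∧
        (∀ b l, P₁₀ b l = (Matrix.of ![a₀, Pi.single b 1, y₁, Pi.single l 1]).permanent) ∧
        (∀ b l, P₀₁ b l = (Matrix.of ![a₁, Pi.single b 1, y₀, Pi.single l 1]).permanent) ∧
        (∀ b l, P₁₁ b l = (Matrix.of ![a₁, Pi.single b 1, y₁, Pi.single l 1]).permanent) ∧
        W₀ * P₀₀ = 1 ∧ (∀ j, P₁₀ *ᵥ v j = s j • P₀₀ *ᵥ v j) ∧ (∀ i j, i ≠ j → s i ≠ s j) ∧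
        W * Matrix.of v = 1 ∧ P₁₁ - P₁₀ * W₀ * P₀₁ ≠ 0) ∧
      (¬
      ∃ (a₀ a₁ y₀ y₁ : Fin 4 → K) (P₀₀ P₁₀ P₀₁ P₁₁ W₀ : Matrix (Fin 4) (Fin 4) K)
        (v : Fin 4 → Fin 4 → K) (s : Fin 4 → K) (W : Matrix (Fin 4) (Fin 4) K),
        a₀ ⬝ᵥ Ψᵀ *ᵥ y₀ = 0 ∧ a₀ ⬝ᵥ Ψᵀ *ᵥ y₁ = 0 ∧ a₁ ⬝ᵥ Ψᵀ *ᵥ y₀ = 0 ∧ a₁ ⬝ᵥ Ψᵀ *ᵥ y₁ = 0 ∧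
        (∀ b l, P₀₀ b l = (Matrix.of ![a₀, Pi.single b 1, y₀, Pi.single l 1]).permanent) ∧
        (∀ b l, P₁₀ b l = (Matrix.of ![a₀, Pi.single b 1, y₁, Pi.single l 1]).permanent) ∧
        (∀ b l, P₀₁ b l = (Matrix.of ![a₁, Pi.single b 1, y₀, Pi.single l 1]).permanent) ∧
        (∀ b l, P₁₁ b l = (Matrix.of ![a₁, Pi.single b 1, y₁, Pi.single l 1]).permanent) ∧
        W₀ * P₀₀ = 1 ∧ (∀ j, P₁₀ *ᵥ v j = s j • P₀₀ *ᵥ v j) ∧ (∀ i j, i ≠ j → s i ≠ s j) ∧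
        W * Matrix.of v = 1 ∧ P₁₁ - P₁₀ * W₀ * P₀₁ ≠ 0) ∧
      (¬
      ∃ (a₀ a₁ y₀ y₁ : Fin 4 → K) (P₀₀ P₁₀ P₀₁ P₁₁ W₀ : Matrix (Fin 4) (Fin 4) K)
        (v : Fin 4 → Fin 4 → K) (s : Fin 4 → K) (W : Matrix (Fin 4) (Fin 4) K),
        a₀ ⬝ᵥ Ψ' *ᵥ y₀ = 0 ∧ a₀ ⬝ᵥ Ψ' *ᵥ y₁ = 0 ∧ a₁ ⬝ᵥ Ψ' *ᵥ y₀ = 0 ∧ a₁ ⬝ᵥ Ψ' *ᵥ y₁ = 0 ∧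
        (∀ b l, P₀₀ b l = (Matrix.of ![a₀, Pi.single b 1, y₀, Pi.single l 1]).permanent) ∧
        (∀ b l, P₁₀ b l = (Matrix.of ![a₀, Pi.single b 1, y₁, Pi.single l 1]).permanent) ∧
        (∀ b l, P₀₁ b l = (Matrix.of ![a₁, Pi.single b 1, y₀, Pi.single l 1]).permanent) ∧
        (∀ b l, P₁₁ b l = (Matrix.of ![a₁, Pi.single b 1, y₁, Pi.single l 1]).permanent) ∧
        W₀ * P₀₀ = 1 ∧ (∀ j, P₁₀ *ᵥ v j = s j • P₀₀ *ᵥ v j) ∧ (∀ i j, i ≠ j → s i ≠ s j) ∧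
        W * Matrix.of v = 1 ∧ P₁₁ - P₁₀ * W₀ * P₀₁ ≠ 0) ∧
      (¬
      ∃ (a₀ a₁ y₀ y₁ : Fin 4 → K) (P₀₀ P₁₀ P₀₁ P₁₁ W₀ : Matrix (Fin 4) (Fin 4) K)
        (v : Fin 4 → Fin 4 → K) (s : Fin 4 → K) (W : Matrix (Fin 4) (Fin 4) K),
        a₀ ⬝ᵥ Ψ'ᵀ *ᵥ y₀ = 0 ∧ a₀ ⬝ᵥ Ψ'ᵀ *ᵥ y₁ = 0 ∧ a₁ ⬝ᵥ Ψ'ᵀ *ᵥ y₀ = 0 ∧ a₁ ⬝ᵥ Ψ'ᵀ *ᵥ y₁ = 0 ∧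
        (∀ b l, P₀₀ b l = (Matrix.of ![a₀, Pi.single b 1, y₀, Pi.single l 1]).permanent) ∧
        (∀ b l, P₁₀ b l = (Matrix.of ![a₀, Pi.single b 1, y₁, Pi.single l 1]).permanent) ∧
        (∀ b l, P₀₁ b l = (Matrix.of ![a₁, Pi.single b 1, y₀, Pi.single l 1]).permanent) ∧
        (∀ b l, P₁₁ b l = (Matrix.of ![a₁, Pi.single b 1, y₁, Pi.single l 1]).permanent) ∧
        W₀ * P₀₀ = 1 ∧ (∀ j, P₁₀ *ᵥ v j = s j • P₀₀ *ᵥ v j) ∧ (∀ i j, i ≠ j → s i ≠ s j) ∧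
        W * Matrix.of v = 1 ∧ P₁₁ - P₁₀ * W₀ * P₀₁ ≠ 0) := by
  classical
  obtain ⟨Ψ, Ψ', hΨ, hΨ', n1, n3⟩ :=
    exists_frameless_pair_of_peeled hκ c t hJ v₀ v₀' hv₀ hv₀' hpeel
  obtain ⟨a', b', yy, zz, hne⟩ := hpeel
  have hv₀ne : v₀ ≠ 0 := by
    intro h0
    apply hne
    obtain ⟨s, hs⟩ := hv₀ a' yy
    refine Finset.sum_eq_zero fun r _ => ?_
    have e : t r (a', 0) (yy, 0) = s * v₀ r := by have := congr_fun hs r; simpa using this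
    rw [e, h0, Pi.zero_apply, mul_zero, mul_zero, zero_mul]
  have hv₀'ne : v₀' ≠ 0 := by
    intro h0
    apply hne
    obtain ⟨s, hs⟩ := hv₀' b' zz
    refine Finset.sum_eq_zero fun r _ => ?_
    have e : t r (0, b') (0, zz) = s * v₀' r := by have := congr_fun hs r; simpa using this
    rw [e, h0, Pi.zero_apply, mul_zero, mul_zero]
  refine ⟨Ψ, Ψ', hΨ, hΨ', n1, fun hb => ?_, n3, fun hb' => ?_⟩
  · refine false_of_peeled_of_frame_at_flip hκ c t hJ v₀ v₀' hv₀ hv₀' ⟨a', b', yy, zz, hne⟩ ?_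
    intro Ψ₁ hΨ₁
    rw [matrix_unique_of_repr (fun a x r => t r (a, 0) (x, 0)) v₀ hv₀ne Ψ₁ Ψ hΨ₁ hΨ]
    exact hb
  · refine false_of_peeled_of_frame_at_mirror_flip hκ c t hJ v₀ v₀' hv₀ hv₀' ⟨a', b', yy, zz, hne⟩
      ?_
    intro Ψ₁ hΨ₁
    rw [matrix_unique_of_repr (fun b x r => t r (0, b) (0, x)) v₀' hv₀'ne Ψ₁ Ψ' hΨ₁ hΨ']
    exact hb'

end Summit.ValiantsHypothesis.ValiantsHypothesis.Theorems.SymPencilPerFourPeeledTwoPencilFramelessFlip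

end
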